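import Literature.NumberTheory.Transcendental.QuadraticRelationsLogarithmsSec6Eps
import HarnessLib

/-!
# Roy–Waldschmidt 1997, §6: quotients by `T₀ × T₁`, Lemme 6.2 and Lemme 6.4

D. Roy, M. Waldschmidt, Ann. Sci. ÉNS (4) 30 (1997) 753–796, §6, pp. 787–788.

* `RWObj.exists_coker_of_subspaces` — for an object `X` of `𝒞` and subspaces `T₀ ⊆ ℂ^{d₀}`
  defined over `K`, `T₁ ⊆ ℂ^{d₁}` defined over `ℚ`, the quotient `g = g₀ × g₁ : X → X'` by
  `T₀ × T₁` (`g₀` the `K`-quotient, `g₁` the integral quotient) is a cokernel of `𝒞`, with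
  `d₀(X') = d₀ - dim T₀`, `d₁(X') = d₁ - dim T₁` (the construction behind Lemme 6.2 and behind the
  passage `L ↦ G/L` of §6 (iv)).
* `RWObj.lemme_6_2` — **Lemme 6.2** (p. 787): every `X` has a cokernel `X → X'` with
  `d₀(X') = d₀(X)`, `d₁(X') = d₁(X) - κ(X)`, `n(X') = n(X) - κ(X)` (quotient by `0 × T₁`, `T₁` the
  `ℚ`-subspace spanned by `Y ∩ (0 × ωℤ^{d₁})`, of dimension `κ`).
* `Ceps.lemme_6_4` — **Lemme 6.4** (p. 788): for `X ∈ 𝒞_ε` with `b_ε(X) ≠ 0`, a minimiser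
  `X → X'` of `a_ε/b_ε` (among cokernels with `b_ε ≠ 0`) with `r_ε(X')` minimal has `κ(X') = 0`.

No named facts.

## References

* [RoyWaldschmidt1997ENS] D. Roy, M. Waldschmidt, Ann. Sci. ÉNS (4) 30 (1997) 753–796,
  Lemme 6.2 p. 787, Lemme 6.4 p. 788 (read on the rendered scan).
-/

noncomputable section

open Complex IntermediateField Module Submodule

namespace Literature.NumberTheory.Transcendental

namespace RoyWaldschmidt1997

open LiePresentation

variable {K : IntermediateField ℚ ℂ} {N : ℕ}

/-! ### Quotients by `T₀ × T₁` -/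

namespace RWObj

set_option maxHeartbeats 800000 in
/-- **The quotient of an object by `T₀ × T₁`** (`T₀` defined over `K`, `T₁` over `ℚ`): a cokernel
`g = g₀ × g₁ : X → X'` of `𝒞` with `ker g = T₀ × T₁`, `g₀` defined over `K`, `g₁` an integer
matrix, `d₀(X') + dim T₀ = d₀(X)`, `d₁(X') + dim T₁ = d₁(X)` (cf. Lemme 6.2 and §6 (iv) (a)).
[cite: RoyWaldschmidt1997ENS, §6, Lemme 6.2 p. 787, (iv) (a) p. 788] -/
theorem exists_coker_of_subspaces (X : RWObj K) (T₀ : Submodule ℂ (Fin X.d₀ → ℂ))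
    (T₁ : Submodule ℂ (Fin X.d₁ → ℂ)) (hT₀ : IsKRational K T₀) (hT₁ : IsKRational ℚ T₁) :
    ∃ (X' : RWObj K) (g : ((Fin X.d₀ → ℂ) × (Fin X.d₁ → ℂ)) →ₗ[ℂ] ((Fin X'.d₀ → ℂ) × (Fin X'.d₁ → ℂ)))
      (g₀ : (Fin X.d₀ → ℂ) →ₗ[ℂ] (Fin X'.d₀ → ℂ)) (g₁ : (Fin X.d₁ → ℂ) →ₗ[ℂ] (Fin X'.d₁ → ℂ)),
      IsCoker X X' g ∧ (∀ p, g p = (g₀ p.1, g₁ p.2)) ∧ LinearMap.ker g₀ = T₀ ∧ LinearMap.ker g₁ = T₁ ∧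
      X'.d₀ + Module.finrank ℂ T₀ = X.d₀ ∧ X'.d₁ + Module.finrank ℂ T₁ = X.d₁ := by
  classical
  obtain ⟨e, g₀, g₀K, hg₀surj, hg₀ker, hg₀K, hdim₀⟩ := exists_kQuot K T₀ hT₀
  obtain ⟨k, g₁, C, hg₁surj, hg₁ker, hg₁C, hfr₁, hk⟩ := exists_intQuot T₁ hT₁
  set g : ((Fin X.d₀ → ℂ) × (Fin X.d₁ → ℂ)) →ₗ[ℂ] ((Fin e → ℂ) × (Fin (X.d₁ - k) → ℂ)) :=
    LinearMap.prodMap g₀ g₁ with hg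
  have hgap : ∀ p, g p = (g₀ p.1, g₁ p.2) := fun p => rfl
  have hgsurj : Function.Surjective g := by
    rintro ⟨u, v⟩
    obtain ⟨u', rfl⟩ := hg₀surj u
    obtain ⟨v', rfl⟩ := hg₁surj v
    exact ⟨(u', v'), rfl⟩
  have hco1 : ∀ u : Fin X.d₀ → ℂ, (∀ i, u i ∈ K) → ∀ i, g₀ u i ∈ K := by
    intro u hu i
    obtain ⟨c, rfl⟩ := exists_ofK_of_mem K hu
    rw [hg₀K]; simp [ofK_apply]
  set W' : Submodule K ((Fin e → ℂ) × (Fin (X.d₁ - k) → ℂ)) := X.W.map (g.restrictScalars K) with hW'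
  set Y' : Submodule ℤ ((Fin e → ℂ) × (Fin (X.d₁ - k) → ℂ)) := X.Y.map (g.restrictScalars ℤ) with hY'
  set Ya' : Submodule ℤ ((Fin e → ℂ) × (Fin (X.d₁ - k) → ℂ)) := X.Ya.map (g.restrictScalars ℤ) with hYa'
  have hW'K : ∀ w ∈ W', (∀ i, w.1 i ∈ K) ∧ (∀ j, w.2 j ∈ K) := by
    rintro _ ⟨w, hw, rfl⟩
    obtain ⟨h1, h2⟩ := X.hW w hw
    refine ⟨fun i => ?_, fun l => ?_⟩
    · show (g w).1 i ∈ K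
      rw [hgap]; exact hco1 w.1 h1 i
    · show (g w).2 l ∈ K
      rw [hgap]; simp only
      rw [hg₁C]
      exact Subalgebra.sum_mem _ fun j _ => mul_mem (intCast_mem _ _) (h2 j)
  have hY'fg : Y'.FG := X.hYfg.map _
  have hY'K : ∀ y ∈ Y', (∀ i, y.1 i ∈ K) ∧ (∀ j, cexp (y.2 j) ∈ K) := by
    rintro _ ⟨y, hy, rfl⟩
    obtain ⟨h1, h2⟩ := X.hY y hy
    refine ⟨fun i => ?_, fun l => ?_⟩
    · show (g y).1 i ∈ K
      rw [hgap]; exact hco1 y.1 h1 i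
    · show cexp ((g y).2 l) ∈ K
      rw [hgap]; simp only
      rw [hg₁C]
      exact cexp_sum_int_mul_mem K _ h2
  have hYa'le : Ya' ≤ Y' := Submodule.map_mono X.hYa
  have hYa'L : ∀ y ∈ Ya', ∀ j, IsAlgebraic ℚ (cexp (y.2 j)) := by
    rintro _ ⟨y, hy, rfl⟩ l
    show IsAlgebraic ℚ (cexp ((g y).2 l))
    rw [hgap]; simp only
    rw [hg₁C]
    exact isAlgebraic_cexp_sum_int_mul _ (X.hYaL y hy)
  let X' : RWObj K := ⟨e, X.d₁ - k, W', hW'K, Y', hY'fg, hY'K, Ya', hYa'le, hYa'L⟩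
  have hgstruct : IsStruct K g :=
    isStruct_of_block g g₀ g₁ hgap (fun c => ⟨g₀K c, hg₀K c⟩) (exists_rat_of_int_matrix C g₁ hg₁C)
  have hcoker : IsCoker X X' g := ⟨⟨hgstruct, le_rfl, le_rfl, le_rfl⟩, hgsurj, rfl, rfl, rfl⟩
  refine ⟨X', g, g₀, g₁, hcoker, hgap, hg₀ker, hg₁ker, by rw [add_comm]; exact hdim₀, ?_⟩
  show X.d₁ - k + Module.finrank ℂ T₁ = X.d₁
  rw [hfr₁]; omega

end RWObj

/-! ### The `ℚ`-subspace spanned by `Y ∩ (0 × ωℤ^{d₁})` -/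

/-- The second components of `Y ∩ (0 × ωℤ^{d₁})` span a `ℚ`-subspace `T₁ ⊆ ℂ^{d₁}` of dimension
`κ(X)`, and `0 × T₁ ⊆ ℂW + ℂY` ("Le sous-espace … engendré par `Y ∩ (0 × ωℤ^{d₁})` est de la forme
`0 × T₁` où `T₁` est un sous-espace de `ℂ^{d₁}` défini sur `ℚ` de dimension `κ`", p. 787).
[cite: RoyWaldschmidt1997ENS, Lemme 6.2 (proof), p. 787] -/
theorem RWObj.exists_T₁_kap (X : RWObj K) :
    ∃ T₁ : Submodule ℂ (Fin X.d₁ → ℂ), IsKRational ℚ T₁ ∧ Module.finrank ℂ T₁ = X.kap ∧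
      (∀ t ∈ T₁, ((0 : Fin X.d₀ → ℂ), t) ∈
        span ℂ ((X.W : Set ((Fin X.d₀ → ℂ) × (Fin X.d₁ → ℂ))) ∪ (X.Y : Set _))) ∧
      (∀ p ∈ X.Y ⊓ omegaLattice X.d₀ X.d₁, p.2 ∈ T₁) := by
  classical
  set Λ := X.Y ⊓ omegaLattice X.d₀ X.d₁ with hΛ
  haveI : Module.Finite ℤ X.Y := X.finite_Y
  haveI : Module.Finite ℤ Λ :=
    Module.Finite.of_injective (Submodule.inclusion (inf_le_left : Λ ≤ X.Y)) (Submodule.inclusion_injective _)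
  haveI : Module.Free ℤ Λ := Module.free_of_finite_type_torsion_free'
  set κ := Module.finrank ℤ Λ with hκ
  let bΛ : Basis (Fin κ) ℤ Λ := Module.finBasis ℤ Λ
  have h2pi : (2 * Real.pi * I : ℂ) ≠ 0 := by simp [Real.pi_ne_zero, I_ne_zero]
  -- integer coordinates of the basis vectors
  have hmem : ∀ i, ((bΛ i : Λ) : (Fin X.d₀ → ℂ) × (Fin X.d₁ → ℂ)) ∈ Λ := fun i => (bΛ i).2
  have hint : ∀ i, ∃ z : Fin X.d₁ → ℤ, ((bΛ i : Λ) : (Fin X.d₀ → ℂ) × (Fin X.d₁ → ℂ)).2 =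
      fun j => (z j : ℂ) * (2 * Real.pi * I) := by
    intro i
    obtain ⟨-, -, h2⟩ := hmem i
    choose z hz using h2
    exact ⟨z, funext hz⟩
  choose z hz using hint
  -- `T₁ = ℂ · {z i}`
  set T₁ : Submodule ℂ (Fin X.d₁ → ℂ) := span ℂ (Set.range fun i => fun j => ((z i j : ℤ) : ℂ)) with hT₁
  -- `ℤ`-independence of the `z i`
  have hzli : LinearIndependent ℤ z := by
    rw [Fintype.linearIndependent_iff]
    intro c hc i
    have hb := (Fintype.linearIndependent_iff.mp bΛ.linearIndependent) c
    refine hb ?_ i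
    rw [← Submodule.coe_eq_zero, Submodule.coe_sum]
    ext j
    · simp only [Prod.fst_sum, Finset.sum_apply, Prod.fst_zero, Pi.zero_apply]
      refine Finset.sum_eq_zero fun i _ => ?_
      obtain ⟨-, h1, -⟩ := hmem i
      rw [Submodule.coe_smul, Prod.smul_fst, h1]; simp
    · simp only [Prod.snd_sum, Finset.sum_apply, Prod.snd_zero, Pi.zero_apply]
      have : ∀ i, (((c i • bΛ i : Λ) : (Fin X.d₀ → ℂ) × (Fin X.d₁ → ℂ))).2 j = (c i : ℂ) * ((z i j : ℂ) * (2 * Real.pi * I)) := by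
        intro i
        rw [Submodule.coe_smul, Prod.smul_snd, hz i, Pi.smul_apply, zsmul_eq_mul]
      simp_rw [this]
      have hcj : (∑ i, c i * z i j : ℤ) = 0 := by
        have := congrFun hc j; simpa [Finset.sum_apply] using this
      have : (∑ i, (c i : ℂ) * ((z i j : ℂ) * (2 * Real.pi * I))) = ((∑ i, c i * z i j : ℤ) : ℂ) * (2 * Real.pi * I) := by
        push_cast; rw [Finset.sum_mul]; refine Finset.sum_congr rfl fun i _ => by ring
      rw [this, hcj]; simp
  -- `dim_ℂ T₁ = κ`
  have hspan := finrank_span_intCast (span ℤ (Set.range z)) (Basis.span hzli)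
  have hbspan : (fun k' : Fin κ => fun j => ((((Basis.span hzli k' : span ℤ (Set.range z)) : Fin X.d₁ → ℤ) j : ℤ) : ℂ)) =
      fun i => fun j => ((z i j : ℤ) : ℂ) := by
    funext i j; rw [Basis.span_apply]
  rw [hbspan] at hspan
  refine ⟨T₁, ?_, ?_, ?_, ?_⟩
  · -- defined over `ℚ`
    refine ⟨Set.range fun i => fun j => (z i j : ℚ), ?_⟩
    rw [hT₁]; congr 1
    ext v; constructor
    · rintro ⟨i, rfl⟩; exact ⟨fun j => (z i j : ℚ), ⟨i, rfl⟩, by funext j; simp [ofK_apply]⟩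
    · rintro ⟨_, ⟨i, rfl⟩, rfl⟩; exact ⟨i, by funext j; simp [ofK_apply]⟩
  · rw [hT₁, hspan.2]; rfl
  · -- `0 × T₁ ⊆ ℂW + ℂY`
    intro t ht
    rw [hT₁] at ht
    induction ht using Submodule.span_induction with
    | mem x hx =>
      obtain ⟨i, rfl⟩ := hx
      obtain ⟨hY, h1, -⟩ := hmem i
      have heq : ((0 : Fin X.d₀ → ℂ), fun j => ((z i j : ℤ) : ℂ)) =
          (2 * Real.pi * I : ℂ)⁻¹ • ((bΛ i : Λ) : (Fin X.d₀ → ℂ) × (Fin X.d₁ → ℂ)) := by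
        ext j
        · simp [h1]
        · rw [Prod.smul_snd, hz i, Pi.smul_apply, smul_eq_mul]; field_simp
      rw [heq]
      exact Submodule.smul_mem _ _ (subset_span (Or.inr hY))
    | zero => have : ((0 : Fin X.d₀ → ℂ), (0 : Fin X.d₁ → ℂ)) = 0 := rfl; rw [this]; exact zero_mem _
    | add x y _ _ hx hy =>
      have : ((0 : Fin X.d₀ → ℂ), x + y) = ((0 : Fin X.d₀ → ℂ), x) + ((0 : Fin X.d₀ → ℂ), y) := by simp
      rw [this]; exact add_mem hx hy
    | smul c x _ hx =>
      have : ((0 : Fin X.d₀ → ℂ), c • x) = c • ((0 : Fin X.d₀ → ℂ), x) := by simp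
      rw [this]; exact Submodule.smul_mem _ _ hx
  · -- second components of `Λ` lie in `T₁`
    intro p hp
    have hrepr := bΛ.sum_repr ⟨p, hp⟩
    have hp' : p = ∑ i, (bΛ.repr ⟨p, hp⟩ i) • ((bΛ i : Λ) : (Fin X.d₀ → ℂ) × (Fin X.d₁ → ℂ)) := by
      have := congrArg (fun l : Λ => (l : (Fin X.d₀ → ℂ) × (Fin X.d₁ → ℂ))) hrepr
      rw [Submodule.coe_sum] at this
      simpa only [Submodule.coe_smul] using this.symm
    have : p.2 = ∑ i, ((bΛ.repr ⟨p, hp⟩ i : ℤ) : ℂ) • ((2 * Real.pi * I : ℂ) • fun j => ((z i j : ℤ) : ℂ)) := by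
      conv_lhs => rw [hp']
      rw [Prod.snd_sum]
      refine Finset.sum_congr rfl fun i _ => ?_
      rw [Prod.smul_snd, hz i]
      funext j
      simp only [Pi.smul_apply, zsmul_eq_mul, smul_eq_mul]
      ring
    rw [this]
    exact Submodule.sum_mem _ fun i _ => Submodule.smul_mem _ _ (Submodule.smul_mem _ _ (subset_span ⟨i, rfl⟩))

/-! ### Lemme 6.2 -/

/-- **Lemme 6.2** (Roy–Waldschmidt 1997, p. 787): every object `X` of `𝒞` has a cokernel
`s : X → X'` with `d₀(X') = d₀(X)`, `d₁(X') = d₁(X) - κ(X)` and `n(X') = n(X) - κ(X)` (the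
quotient by `0 × T₁`). [cite: RoyWaldschmidt1997ENS, Lemme 6.2, p. 787] -/
theorem RWObj.lemme_6_2 (X : RWObj K) :
    ∃ (X' : RWObj K) (g : ((Fin X.d₀ → ℂ) × (Fin X.d₁ → ℂ)) →ₗ[ℂ] ((Fin X'.d₀ → ℂ) × (Fin X'.d₁ → ℂ))),
      IsCoker X X' g ∧ X'.dd₀ = X.dd₀ ∧ X'.dd₁ + X.kap = X.dd₁ ∧ X'.nn + X.kap = X.nn := by
  classical
  obtain ⟨T₁, hT₁Q, hT₁dim, hT₁S, -⟩ := X.exists_T₁_kap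
  have hbot : IsKRational K (⊥ : Submodule ℂ (Fin X.d₀ → ℂ)) := ⟨∅, by simp⟩
  obtain ⟨X', g, g₀, g₁, hcoker, hgap, hker₀, hker₁, hd₀, hd₁⟩ := X.exists_coker_of_subspaces ⊥ T₁ hbot hT₁Q
  refine ⟨X', g, hcoker, ?_, ?_, ?_⟩
  · simp only [RWObj.dd₀]; rw [finrank_bot] at hd₀; omega
  · simp only [RWObj.dd₁]; rw [hT₁dim] at hd₁; exact hd₁
  · -- `n(X') = n(X) - κ(X)`: `ker g = 0 × T₁ ⊆ ℂW + ℂY`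
    simp only [RWObj.nn]
    have hmap := span_map_of_isCoker hcoker
    set S := span ℂ ((X.W : Set ((Fin X.d₀ → ℂ) × (Fin X.d₁ → ℂ))) ∪ (X.Y : Set _)) with hS
    have h1 := finrank_map_add_finrank_inf_ker_field S g
    rw [hmap] at h1
    have hker : LinearMap.ker g = (⊥ : Submodule ℂ (Fin X.d₀ → ℂ)).prod T₁ := by
      ext ⟨u, v⟩
      rw [LinearMap.mem_ker, hgap, Prod.mk_eq_zero, Submodule.mem_prod, ← LinearMap.mem_ker, ← LinearMap.mem_ker,
        hker₀, hker₁]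
    have hkerS : LinearMap.ker g ≤ S := by
      rw [hker]
      rintro ⟨u, v⟩ ⟨hu, hv⟩
      have hu' : u = 0 := hu
      subst hu'
      exact hT₁S v hv
    rw [inf_eq_right.mpr hkerS] at h1
    have h2 : Module.finrank ℂ (LinearMap.ker g) = X.kap := by
      obtain ⟨-, hsurj, -, -, -⟩ := hcoker
      have h3 := LinearMap.finrank_range_add_finrank_ker g
      rw [LinearMap.range_eq_top.mpr hsurj, finrank_top, Module.finrank_prod, Module.finrank_prod,
        Module.finrank_fin_fun, Module.finrank_fin_fun, Module.finrank_fin_fun, Module.finrank_fin_fun] at h3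
      rw [finrank_bot] at hd₀
      rw [hT₁dim] at hd₁
      omega
    omega

namespace Ceps

/-! ### Lemme 6.4 -/

/-- **Lemme 6.4** (Roy–Waldschmidt 1997, p. 788): let `X ∈ 𝒞_ε` with `b_ε(X) ≠ 0`; then (the family
of cokernels `X → X'` with `b_ε(X') ≠ 0` minimising `a_ε/b_ε` being non-empty, cf.
`Ceps.enonce2_of_enonce1`) every such minimiser `X₁` with `r_ε(X₁)` minimal among the minimisers
has `κ(X₁) = 0`: otherwise Lemme 6.2 produces a further cokernel `X₁ → X₂` with
`r(X₂) < r(X₁)`, `a(X₂) ≤ a(X₁)`, `b(X₂) ≥ b(X₁)`. [cite: RoyWaldschmidt1997ENS, Lemme 6.4, p. 788] -/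
theorem lemme_6_4 (X X₁ : Ceps K N) (hQ₁ : Quot X X₁) (hb₁ : X₁.1.bE N ≠ 0)
    (hmin : ∀ X' : Ceps K N, (Quot X X' ∧ X'.1.bE N ≠ 0) → X₁.1.aE N * X'.1.bE N ≤ X'.1.aE N * X₁.1.bE N)
    (hrmin : ∀ X' : Ceps K N, (Quot X X' ∧ X'.1.bE N ≠ 0) →
      (∀ X'', (Quot X X'' ∧ X''.1.bE N ≠ 0) → X'.1.aE N * X''.1.bE N ≤ X''.1.aE N * X'.1.bE N) →
      X₁.1.rE N ≤ X'.1.rE N) :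
    X₁.1.kap = 0 := by
  by_contra hk
  have hk1 : 1 ≤ X₁.1.kap := Nat.pos_of_ne_zero hk
  -- Lemme 6.2 for `X₁`
  obtain ⟨X₂', g, hcoker, hd₀, hd₁, hn⟩ := X₁.1.lemme_6_2
  obtain ⟨Xs, hex⟩ := hcoker.exists_exact
  have hmem₂ : 2 * X₂'.dd * (X₂'.dd + X₂'.ell₁) + 1 ≤ N := mem_of_exact_right hex X₁.2
  let X₂ : Ceps K N := ⟨X₂', hmem₂⟩
  have hQ₂ : Quot X X₂ := quot_trans X X₁ X₂ hQ₁ ⟨g, hcoker⟩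
  -- numerical facts
  have hN := one_le_N X
  have hk2 := X₁.1.kap_le_dd₁
  have hk3 := X₁.1.kapA_le_kap
  have hk4 := X₂'.kapA_le_kap
  have hk5 := X₂'.kap_le_dd₁
  have hl1 : 1 ≤ X₁.1.ell₁ := le_trans hk1 X₁.1.kap_le_ell₁
  have hd1 : 1 ≤ X₁.1.dd := le_trans (le_trans hk1 hk2) (Nat.le_add_left _ _)
  have hN5 : 5 ≤ N := by
    have := X₁.2
    nlinarith
  have hNN : 1 ≤ N ^ 2 - N := by
    have : N ^ 2 ≥ 2 * N := by nlinarith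
    omega
  -- `a(X₂) ≤ a(X₁)`
  have ha : X₂'.aE N ≤ X₁.1.aE N := by
    simp only [RWObj.aE]
    refine Nat.mul_le_mul_left _ ?_
    omega
  -- `b(X₂) ≥ b(X₁)`
  have hb : X₁.1.bE N ≤ X₂'.bE N := by
    simp only [RWObj.bE]
    have e1 : N ^ 2 * X₁.1.dd₁ = N ^ 2 * X₂'.dd₁ + N ^ 2 * X₁.1.kap := by rw [← hd₁, Nat.mul_add]
    have e2 : (2 * N ^ 2 - N) * X₁.1.nn = (2 * N ^ 2 - N) * X₂'.nn + (2 * N ^ 2 - N) * X₁.1.kap := by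
      rw [← hn, Nat.mul_add]
    have e3 : (2 * N ^ 2 - N) * X₁.1.kap = N ^ 2 * X₁.1.kap + (N ^ 2 - N) * X₁.1.kap := by
      rw [← Nat.add_mul]; congr 1; omega
    have e4 : X₁.1.kapA ≤ (N ^ 2 - N) * X₁.1.kap := le_trans hk3 (by nlinarith)
    have e5 : (N ^ 2 - N) * X₂'.dd₀ = (N ^ 2 - N) * X₁.1.dd₀ := by rw [hd₀]
    omega
  -- `r(X₂) < r(X₁)`
  have hr : X₂'.rE N < X₁.1.rE N := by
    simp only [RWObj.rE, RWObj.dd]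
    simp only [RWObj.dd₀, RWObj.dd₁] at hd₀ hd₁
    have : X₂'.d₀ + X₂'.d₁ < X₁.1.d₀ + X₁.1.d₁ := by omega
    exact Nat.mul_lt_mul_of_pos_left this (by positivity)
  -- `X₂` is again a minimiser, contradicting the minimality of `r(X₁)`
  have hb₂ : X₂'.bE N ≠ 0 := by omega
  have hmin₂ : ∀ X'' : Ceps K N, (Quot X X'' ∧ X''.1.bE N ≠ 0) → X₂.1.aE N * X''.1.bE N ≤ X''.1.aE N * X₂.1.bE N := by
    intro X'' hX''
    have h1 := hmin X'' hX''
    have h2 := hmin X₂ ⟨hQ₂, hb₂⟩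
    -- `a₂ b₁ ≤ a₁ b₂` and `a₁ b₂ ≤ a₂ b₁` give `a₂ b₁ = a₁ b₂`; then compare via `b₁ > 0`
    have h3 : X₂.1.aE N * X₁.1.bE N ≤ X₁.1.aE N * X₂.1.bE N := Nat.mul_le_mul ha hb
    have heq : X₂.1.aE N * X₁.1.bE N = X₁.1.aE N * X₂.1.bE N := le_antisymm h3 h2
    have key : X₂.1.aE N * X''.1.bE N * X₁.1.bE N ≤ X''.1.aE N * X₂.1.bE N * X₁.1.bE N := by
      calc X₂.1.aE N * X''.1.bE N * X₁.1.bE N = (X₂.1.aE N * X₁.1.bE N) * X''.1.bE N := by ring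
        _ = (X₁.1.aE N * X₂.1.bE N) * X''.1.bE N := by rw [heq]
        _ = (X₁.1.aE N * X''.1.bE N) * X₂.1.bE N := by ring
        _ ≤ (X''.1.aE N * X₁.1.bE N) * X₂.1.bE N := Nat.mul_le_mul_right _ h1
        _ = X''.1.aE N * X₂.1.bE N * X₁.1.bE N := by ring
    exact Nat.le_of_mul_le_mul_right key (Nat.pos_of_ne_zero hb₁)
  have := hrmin X₂ ⟨hQ₂, hb₂⟩ hmin₂
  exact absurd this (not_le.mpr hr)

end Ceps

end RoyWaldschmidt1997

end Literature.NumberTheory.Transcendental
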